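import Summits.CriticalPhenomena.PercolationContinuityZ3.Theorems.Transplant.SkelFrmFromBChoiceSlotsPx
import HarnessLib

/-!
# U_s execution (RULING D-Us / Us-R6 / Us-R8, lead g22 2026-08-27; design owner p3 g27): «SkelFrmFromBChoiceSlotCongrPx» — **SLOT CONGRUENCE AT THE MERGED
# RECORD**: the N2/U choice data `choiceAtQ3V … gv fv …` read the box/width slots ONLY through their VALUES at `O.merged` (`gOf`, `fOf`), so two slot pairs that
# AGREE AT `O.merged` give the same `AtQNQ O q`, the same scheme, face data and level data at `(O, q)` — the junction by which the (F) column's rows, which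
# are stated at FIXED-shape slots `KS.gT mkP gx / KS.fT mkP fx` (the U face chain «…BFaceBVC2/BVC1/…» bakes that shape in), serve the TUPLE Px OF RECORD
# `gvPx D / fvPx D` («SkelFrmFromBChoiceSlotsPx», index `KS.RK t O.merged 0 + D` varying with the record)

builds on p205010 (kernel theorem, internal audit signed; external expert review pending) — nothing in this file uses p205010; NOTHING is claimed about the
OPEN node U_s `SamePDropOfSkeletonFrmScaled₁`.  Lane `prim-bschramm`, seat `prim-bschramm-p3` gen 27 (design owner); helper file (`--supports
stmt-CriticalPhenomena-4575 --as helper`); PROOFS ONLY (no definition, no statement).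
§1 value congruence (`gOf/fOf/cOf/hOf/bOf`); §2 `ΓQV/FDQV/LDQV` congruence; §3 `choiceAtQ3V`: `AtQNQ` (iff), `scheme`, `FD`, `LD` congruence; §4 the
specialisation to the tuple of record: at `(O, q)` the tuple's g/f slots `gvPx D / fvPx D` may be replaced by the FIXED-shape slots
`KS.gT m′ (gxQ m′ (gxR0 m′) (fxR m′)) / KS.fT m′ (fxQ m′ (fxR m′))` with `m′ := KS.RK t O.merged 0 + D` (`gvPx_at`/`fvPx_at`, rfl) — RECIPE FOR THE (F) TOP
(hp-8 g57): from the node's `hAt` (Px data at the tuple) take `atQ3V_of_atQ3VPx`, then `(atQ3V_tuplePx_iff D).1` to reach the fixed-shape `hAt` the (F) rows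
(«…BFaceBVC3Px/BVC5Px/HoldsQ3VOfPx», slots `KS.gT mkP gx`) consume with `mkP := m′`, and rewrite the conclusion back with `scheme_tuplePx_eq / FD_tuplePx_eq`.
[cite: KozmaNitzan2024, §4 Theorem 6 (pp. 25–31)] [this work]
-/

noncomputable section

open scoped Classical

namespace Summit.CriticalPhenomena.PercolationContinuityZ3.Theorems.Transplant

open MeasureTheory Literature.Probability.Percolation Literature.Probability.LatticeModels SimpleGraph KNCells KNLevels
open SkelConc (Consts)
open Skelφ.StepI (DataN DataNS OutNS)

namespace PlanarSkeletonFrmFrom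

namespace NegB

open Neg

section Congr

variable {κ : Consts} {V : Type} [DecidableEq V] [Countable V] {G : SimpleGraph V} [G.LocallyFinite] {Φ : PlanarSkeletonFrmFrom G} {t : V} {p : unitInterval}
  {hC : Φ.CylSubcritical p} {Pv : PSlot} {Sv : SSlot} {cv hv : CSlot} {bv : BSlot} {O : OutNS V} {q : unitInterval}
  {gv₁ gv₂ fv₁ fv₂ : Neg.FSlot}

/-! ## §1 The slot values at the merged record -/

/-- Box slots agreeing at `O.merged` have the same `gOf`. [folklore] -/
theorem gOf_congr (hg : gv₁ κ Φ t p O.merged = gv₂ κ Φ t p O.merged) : gOf κ Φ t p O gv₁ = gOf κ Φ t p O gv₂ := hg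

/-- Width slots agreeing at `O.merged` have the same `fOf`. [folklore] -/
theorem fOf_congr (hf : fv₁ κ Φ t p O.merged = fv₂ κ Φ t p O.merged) : fOf κ Φ t p O fv₁ = fOf κ Φ t p O fv₂ := hf

/-- … the same creep value `cOf`. [folklore] -/
theorem cOf_congr (hg : gv₁ κ Φ t p O.merged = gv₂ κ Φ t p O.merged) (hf : fv₁ κ Φ t p O.merged = fv₂ κ Φ t p O.merged) :
    cOf κ Φ t p O gv₁ fv₁ cv = cOf κ Φ t p O gv₂ fv₂ cv := by
  unfold cOf; rw [gOf_congr hg, fOf_congr hf]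

/-- … the same forward-room value `hOf`. [folklore] -/
theorem hOf_congr (hg : gv₁ κ Φ t p O.merged = gv₂ κ Φ t p O.merged) (hf : fv₁ κ Φ t p O.merged = fv₂ κ Φ t p O.merged) :
    hOf κ Φ t p O gv₁ fv₁ hv = hOf κ Φ t p O gv₂ fv₂ hv := by
  unfold hOf; rw [gOf_congr hg, fOf_congr hf]

/-- … the same arrival boxes `bOf`. [folklore] -/
theorem bOf_congr (hg : gv₁ κ Φ t p O.merged = gv₂ κ Φ t p O.merged) (hf : fv₁ κ Φ t p O.merged = fv₂ κ Φ t p O.merged) :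
    bOf κ Φ t p O gv₁ fv₁ bv = bOf κ Φ t p O gv₂ fv₂ bv := by
  unfold bOf; rw [gOf_congr hg, fOf_congr hf]

/-! ## §2 The scheme, face data and level data of record -/

/-- Slots agreeing at `O.merged` give the same scheme of record `ΓQV` at `(O, q)`. [folklore] -/
theorem ΓQV_congr (hg : gv₁ κ Φ t p O.merged = gv₂ κ Φ t p O.merged) (hf : fv₁ κ Φ t p O.merged = fv₂ κ Φ t p O.merged) :
    ΓQV κ Φ t p O gv₁ fv₁ Sv cv hv bv q = ΓQV κ Φ t p O gv₂ fv₂ Sv cv hv bv q := by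
  unfold ΓQV; rw [gOf_congr hg, fOf_congr hf, cOf_congr hg hf, hOf_congr hg hf, bOf_congr hg hf]

/-- … the same face data `FDQV`. [folklore] -/
theorem FDQV_congr (hg : gv₁ κ Φ t p O.merged = gv₂ κ Φ t p O.merged) (hf : fv₁ κ Φ t p O.merged = fv₂ κ Φ t p O.merged) :
    FDQV κ Φ t p O gv₁ fv₁ Sv cv hv q = FDQV κ Φ t p O gv₂ fv₂ Sv cv hv q := by
  unfold FDQV; rw [gOf_congr hg, fOf_congr hf, cOf_congr hg hf, hOf_congr hg hf]

/-- … the same level data `LDQV`. [folklore] -/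
theorem LDQV_congr (hg : gv₁ κ Φ t p O.merged = gv₂ κ Φ t p O.merged) (hf : fv₁ κ Φ t p O.merged = fv₂ κ Φ t p O.merged) :
    LDQV κ Φ t p O gv₁ fv₁ cv hv = LDQV κ Φ t p O gv₂ fv₂ cv hv := by
  unfold LDQV; rw [gOf_congr hg, fOf_congr hf, cOf_congr hg hf, hOf_congr hg hf]

/-! ## §3 The choice data of record -/

/-- **`AtQNQ` CONGRUENCE**: slots agreeing at `O.merged` give the same premises at `q` (the only slot-dependent datum `AtQNQ` reads is the pair list
`SMn O = SMnP … (gOf …) (fOf …) Pv`). [this work] -/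
theorem atQ3V_congr (hg : gv₁ κ Φ t p O.merged = gv₂ κ Φ t p O.merged) (hf : fv₁ κ Φ t p O.merged = fv₂ κ Φ t p O.merged) :
    (choiceAtQ3V κ Φ t p Pv gv₁ fv₁ Sv cv hv bv hC).AtQNQ O q ↔ (choiceAtQ3V κ Φ t p Pv gv₂ fv₂ Sv cv hv bv hC).AtQNQ O q := by
  have hS : (choiceAtQ3V κ Φ t p Pv gv₁ fv₁ Sv cv hv bv hC).SMn O = (choiceAtQ3V κ Φ t p Pv gv₂ fv₂ Sv cv hv bv hC).SMn O := by
    show SMnP κ Φ t p O.merged (gOf κ Φ t p O gv₁) (fOf κ Φ t p O fv₁) Pv = SMnP κ Φ t p O.merged (gOf κ Φ t p O gv₂) (fOf κ Φ t p O fv₂) Pv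
    rw [gOf_congr hg, fOf_congr hf]
  unfold ChoiceNQ.AtQNQ
  rw [hS]
  exact Iff.rfl

/-- **Scheme congruence**: slots agreeing at `O.merged` give the same scheme at `(O, q)`. [folklore] -/
theorem scheme_congr (hg : gv₁ κ Φ t p O.merged = gv₂ κ Φ t p O.merged) (hf : fv₁ κ Φ t p O.merged = fv₂ κ Φ t p O.merged) :
    (choiceAtQ3V κ Φ t p Pv gv₁ fv₁ Sv cv hv bv hC).scheme O q = (choiceAtQ3V κ Φ t p Pv gv₂ fv₂ Sv cv hv bv hC).scheme O q := by
  rw [choiceAtQ3V_scheme, choiceAtQ3V_scheme, ΓQV_congr hg hf]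

/-- **Face-data congruence**. [folklore] -/
theorem FD_congr (hg : gv₁ κ Φ t p O.merged = gv₂ κ Φ t p O.merged) (hf : fv₁ κ Φ t p O.merged = fv₂ κ Φ t p O.merged) :
    (choiceAtQ3V κ Φ t p Pv gv₁ fv₁ Sv cv hv bv hC).FD O q = (choiceAtQ3V κ Φ t p Pv gv₂ fv₂ Sv cv hv bv hC).FD O q := by
  rw [choiceAtQ3V_FD, choiceAtQ3V_FD, FDQV_congr hg hf]

/-- **Level-data congruence**. [folklore] -/
theorem LD_congr (hg : gv₁ κ Φ t p O.merged = gv₂ κ Φ t p O.merged) (hf : fv₁ κ Φ t p O.merged = fv₂ κ Φ t p O.merged) :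
    (choiceAtQ3V κ Φ t p Pv gv₁ fv₁ Sv cv hv bv hC).LD O q = (choiceAtQ3V κ Φ t p Pv gv₂ fv₂ Sv cv hv bv hC).LD O q := by
  rw [choiceAtQ3V_LD, choiceAtQ3V_LD, LDQV_congr hg hf]

end Congr

/-! ## §4 The tuple of record versus the fixed-shape slots at the raised index (what the (F) top rewrites with) -/

section Tuple

variable {κ : Consts} {V : Type} [DecidableEq V] [Countable V] {G : SimpleGraph V} [G.LocallyFinite] {Φ : PlanarSkeletonFrmFrom G} {t : V} {p : unitInterval}
  {hC : Φ.CylSubcritical p} {Pv : PSlot} {Sv : SSlot} {cv hv : CSlot} {bv : BSlot} {O : OutNS V} {q : unitInterval} (D : ℕ)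

/-- **`AtQNQ` AT THE TUPLE ⇔ `AtQNQ` AT THE FIXED-SHAPE SLOTS of the raised index `m′ := KS.RK t O.merged 0 + D`** — the (F) rows' `hAt`. [this work] -/
theorem atQ3V_tuplePx_iff :
    (choiceAtQ3V κ Φ t p Pv (gvPx D) (fvPx D) Sv cv hv bv hC).AtQNQ O q ↔
      (choiceAtQ3V κ Φ t p Pv
        (KS.gT (KS.RK t O.merged 0 + D) (gxQ (KS.RK t O.merged 0 + D) (gxR0 (KS.RK t O.merged 0 + D)) (fxR (KS.RK t O.merged 0 + D))))
        (KS.fT (KS.RK t O.merged 0 + D) (fxQ (KS.RK t O.merged 0 + D) (fxR (KS.RK t O.merged 0 + D)))) Sv cv hv bv hC).AtQNQ O q :=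
  atQ3V_congr (gvPx_at κ Φ t p O.merged D) (fvPx_at κ Φ t p O.merged D)

/-- **The scheme at the tuple = the scheme at the fixed-shape slots of the raised index.** [folklore] -/
theorem scheme_tuplePx_eq :
    (choiceAtQ3V κ Φ t p Pv (gvPx D) (fvPx D) Sv cv hv bv hC).scheme O q =
      (choiceAtQ3V κ Φ t p Pv
        (KS.gT (KS.RK t O.merged 0 + D) (gxQ (KS.RK t O.merged 0 + D) (gxR0 (KS.RK t O.merged 0 + D)) (fxR (KS.RK t O.merged 0 + D))))
        (KS.fT (KS.RK t O.merged 0 + D) (fxQ (KS.RK t O.merged 0 + D) (fxR (KS.RK t O.merged 0 + D)))) Sv cv hv bv hC).scheme O q :=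
  scheme_congr (gvPx_at κ Φ t p O.merged D) (fvPx_at κ Φ t p O.merged D)

/-- **The face data at the tuple = the face data at the fixed-shape slots of the raised index.** [folklore] -/
theorem FD_tuplePx_eq :
    (choiceAtQ3V κ Φ t p Pv (gvPx D) (fvPx D) Sv cv hv bv hC).FD O q =
      (choiceAtQ3V κ Φ t p Pv
        (KS.gT (KS.RK t O.merged 0 + D) (gxQ (KS.RK t O.merged 0 + D) (gxR0 (KS.RK t O.merged 0 + D)) (fxR (KS.RK t O.merged 0 + D))))
        (KS.fT (KS.RK t O.merged 0 + D) (fxQ (KS.RK t O.merged 0 + D) (fxR (KS.RK t O.merged 0 + D)))) Sv cv hv bv hC).FD O q :=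
  FD_congr (gvPx_at κ Φ t p O.merged D) (fvPx_at κ Φ t p O.merged D)

/-- `gOf` of the tuple's box slot is the fixed-shape value at the raised index (by `rfl`). [folklore] -/
theorem gOf_gvPx : gOf κ Φ t p O (gvPx D) =
    KS.gT (KS.RK t O.merged 0 + D) (gxQ (KS.RK t O.merged 0 + D) (gxR0 (KS.RK t O.merged 0 + D)) (fxR (KS.RK t O.merged 0 + D))) κ Φ t p O.merged := rfl

/-- `fOf` of the tuple's width slot is the fixed-shape value at the raised index (by `rfl`). [folklore] -/
theorem fOf_fvPx : fOf κ Φ t p O (fvPx D) = KS.fT (KS.RK t O.merged 0 + D) (fxQ (KS.RK t O.merged 0 + D) (fxR (KS.RK t O.merged 0 + D))) κ Φ t p O.merged := rfl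

end Tuple

end NegB

end PlanarSkeletonFrmFrom

end Summit.CriticalPhenomena.PercolationContinuityZ3.Theorems.Transplant

end
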